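import Mathlib
import Summits.ValiantsHypothesis.ValiantsHypothesis.Theorems.GrenetZeonPolySizeQPAlgebraSquareZeroIdeal
import Summits.ValiantsHypothesis.ValiantsHypothesis.Theorems.GrenetZeonPolySizeQPAlgebraMaximalMinorTransport
import HarnessLib

/-!
# Crux `GrenetZeon.PolySizeQPAlgebra` (stmt-ValiantsHypothesis-8064), line `vbp-slice-dealg` —
# square-zero coefficient algebras: the local Hessian bound at points of residual corank `≥ 4` and `= 3`

Combination of the maximal-minor transport (`…MaximalMinorTransport`) with the normal-form counts for
square-zero residual blocks (`…SquareZeroIdeal`).  Let `R` be a finite-dimensional commutative `ℂ`-algebra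
with a character `φ` whose kernel `𝔪` is SQUARE-ZERO (`𝔪 · 𝔪 = 0`; e.g. `ℂ[x]/x²`, `ℂ[x,y]/(x,y)²`, every
`ℂ ⊕ V`), `A` affine with read-out `F = λ(det A)`, and `p` a point with a residually maximal minor
`(r, c)` of `A(p)` of size `|κ|`, `|ι| = |κ| + |m|` (`|m|` = residual corank):

* `hess0_transl_rank_eq_zero_of_sqZero_point` — **if the residual corank is `≥ 4`, `Hess F(p) = 0`**
  (rank `0`).
* `rank_hess0_transl_le_of_sqZero_point_three` — if the residual corank is `3` and `|κ| ≥ 2` (`n ≥ 5`),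
  `rank Hess F(p) ≤ 2 · dim R · n`.

With `…ResidualCorankOne` (`q = 1`) and `…ResidualCorankTwo` (`q ≤ 2`) this is the type-independent
input `LocalHessianBound` for all square-zero types at every point except residual corank `3` with
`n ≤ 4`.  Remaining packaging (not here): the choice of a maximal residual minor at an arbitrary point
(finite maximisation + cofactor descent) to state it in the `Fin n` form of `…LocalReductionResidualThree`.
HONEST FRAMING: rank counts; no stub of the line is closed; VP ≠ VNP is not moved.

References: T. Mignon, N. Ressayre, IMRN 2004:79, §2 [MignonRessayre2004].
-/

noncomputable section

open MvPolynomial Matrix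
open Literature.Computability.AlgebraicComplexity

-- single-conjunct layout `Summits/ValiantsHypothesis/ValiantsHypothesis`: duplicated namespace by design
set_option linter.dupNamespace false

namespace Summit.ValiantsHypothesis.ValiantsHypothesis.Theorems.GrenetZeonPolySizeQPAlgebra

section SqZeroPoints

variable {ι κ m σ : Type*} [Fintype ι] [DecidableEq ι] [Fintype κ] [DecidableEq κ] [Fintype m]
  [DecidableEq m] [Fintype σ] [DecidableEq σ] {R : Type*} [CommRing R] [Algebra ℂ R] [Module.Finite ℂ R]

omit [Fintype ι] [DecidableEq ι] [Fintype κ] [DecidableEq κ] [Fintype m] [DecidableEq m] [Fintype σ]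
  [DecidableEq σ] [Module.Finite ℂ R] in
/-- A square-zero kernel is nilpotent of index `2`. [folklore] -/
theorem ker_pow_two_eq_bot_of_sqZero (φ : R →ₐ[ℂ] ℂ) (hsq : ∀ a b : R, φ a = 0 → φ b = 0 → a * b = 0) :
    RingHom.ker (φ : R →+* ℂ) ^ 2 = ⊥ := by
  rw [pow_two, eq_bot_iff, Ideal.mul_le]
  intro a ha b hb
  rw [Ideal.mem_bot]
  exact hsq a b (by simpa using ha) (by simpa using hb)

omit [Module.Finite ℂ R] in
/-- **Square-zero algebras, residual corank `≥ 4`: the Hessian vanishes.**  For `R` with a character `φ`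
of square-zero kernel, `F = λ(det A)` with `A` affine, and a point `p` with a residually maximal minor
`(r, c)` of `A(p)` of co-size `|m| ≥ 4`: `rank Hess F(p) = 0`. [cite: MignonRessayre2004, §2] -/
theorem hess0_transl_rank_eq_zero_of_sqZero_point (φ : R →ₐ[ℂ] ℂ)
    (hsq : ∀ a b : R, φ a = 0 → φ b = 0 → a * b = 0) (l : R →ₗ[ℂ] ℂ)
    (A : Matrix ι ι (MvPolynomial σ R)) (F : MvPolynomial σ ℂ) (hA : ∀ a b, (A a b).totalDegree ≤ 1)
    (hF : ∀ d, l (coeff d A.det) = coeff d F) (p : σ → ℂ) (r c : κ → ι)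
    (hu : φ ((A.map (eval fun i => algebraMap ℂ R (p i))).submatrix r c).det ≠ 0)
    (hmax : ∀ a b : ι, φ ((A.map (eval fun i => algebraMap ℂ R (p i))).submatrix
      (Sum.elim r fun _ : Unit => a) (Sum.elim c fun _ : Unit => b)).det = 0)
    (hcard : Fintype.card ι = Fintype.card κ + Fintype.card m) (hm : 4 ≤ Fintype.card m) :
    (hess0 (transl p F)).rank = 0 := by
  refine Nat.le_zero.1 (rank_hess0_transl_le_of_maximal_minor (m := m) φ
    (ker_pow_two_eq_bot_of_sqZero φ hsq) l A F hA hF p r c hu hmax hcard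
    fun l' A' S hA' hF' hB' hS => ?_)
  rw [hess0_transl_eq_zero_of_sqZero (RingHom.ker (φ : R →+* ℂ))
    (fun a ha b hb => hsq a b (by simpa using ha) (by simpa using hb)) l' A' F hA' hF' p S hB'
    (fun i j => by simpa using hS i j) hm, Matrix.rank_zero]

/-- **Square-zero algebras, residual corank `3`, `n ≥ 5`.**  Under the same hypotheses with co-size
`|m| = 3` and `|κ| ≥ 2`: `rank Hess F(p) ≤ 2 · dim_ℂ R · |ι|`. [cite: MignonRessayre2004, §2] -/
theorem rank_hess0_transl_le_of_sqZero_point_three (φ : R →ₐ[ℂ] ℂ)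
    (hsq : ∀ a b : R, φ a = 0 → φ b = 0 → a * b = 0) (l : R →ₗ[ℂ] ℂ)
    (A : Matrix ι ι (MvPolynomial σ R)) (F : MvPolynomial σ ℂ) (hA : ∀ a b, (A a b).totalDegree ≤ 1)
    (hF : ∀ d, l (coeff d A.det) = coeff d F) (p : σ → ℂ) (r c : κ → ι)
    (hu : φ ((A.map (eval fun i => algebraMap ℂ R (p i))).submatrix r c).det ≠ 0)
    (hmax : ∀ a b : ι, φ ((A.map (eval fun i => algebraMap ℂ R (p i))).submatrix
      (Sum.elim r fun _ : Unit => a) (Sum.elim c fun _ : Unit => b)).det = 0)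
    (hcard : Fintype.card ι = Fintype.card κ + Fintype.card m) (hm : Fintype.card m = 3)
    (hk : 2 ≤ Fintype.card κ) :
    (hess0 (transl p F)).rank ≤ 2 * Module.finrank ℂ R * Fintype.card ι := by
  refine rank_hess0_transl_le_of_maximal_minor (m := m) φ (ker_pow_two_eq_bot_of_sqZero φ hsq) l A F
    hA hF p r c hu hmax hcard fun l' A' S hA' hF' hB' hS => ?_
  rw [hcard]
  exact rank_hess0_transl_le_of_sqZero (RingHom.ker (φ : R →+* ℂ))
    (fun a ha b hb => hsq a b (by simpa using ha) (by simpa using hb)) l' A' F hA' hF' p S hB'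
    (fun i j => by simpa using hS i j) (by omega) (by rw [hm]; omega)

end SqZeroPoints

end Summit.ValiantsHypothesis.ValiantsHypothesis.Theorems.GrenetZeonPolySizeQPAlgebra

end
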